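import Mathlib
import Summits.Ventures.PercRepro2.TypedSmallVertexReduction
import Summits.Ventures.PercRepro2.TypedSixVertex
import Summits.Ventures.PercRepro2.TypedBundleSpine

/-!
# The root-bundle composition on the class with at most two unmarked typed vertices, and the
seven-vertex hypothesis without the hanging vertices (blind cell PercRepro2, mine-2 g43,
2026-08-29; `proofs/MINE2-SEVEN.md` §5, row M2-88)

p2's root-bundle identity (`typedCount_rootBundle`, TypedRootBundle.lean) writes the typed count
of an instance carrying an unmarked part `I` hanging on the two roots and one more vertex `v` as
a nonnegative integer combination of the counts of the VIRTUAL instances `B + v–a₁(k₁) + v–a₂(k₂)`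
(`k₁, k₂ ≤ 3`).  The virtual instance has the unmarked typed vertices of the rest `F \ L`, plus
`v` when `v` is unmarked — so when that is at most ONE vertex, the virtual instances are theorems
of the tree (`typedCount_nonneg_of_unmarked_le_one`, TypedSixVertex.lean; the types `0` / `3` of
the virtual edges pinned by `typedCount_mixed_of_le_three`).

* **`typedCount_nonneg_of_rootBundle_rest_le_one`** — the composition, for every pinning;
* **`Hangs`**, **`typedCount_nonneg_of_hangs_unmarked_le_two`** — on an instance with at most two
  unmarked typed vertices, if one of them HANGS on the roots and a vertex `v` (every typed edge at
  it goes to `v`, `a₁` or `a₂`, some typed edge to `v`; `v` a mark — a hat — or the other unmarked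
  vertex — the adjacent pair `u ~ {a₁, a₂, w}`), the count is nonnegative;
* **`HCov_of_card_le_seven_of_residual_noHang`** — (HCOV) on every graph with at most seven
  vertices from row 2′TRI on the residual instances with at most two unmarked typed vertices NONE
  of which hangs on the roots and a third vertex: the seven-vertex hypothesis of
  `HCov_of_card_le_seven_of_residual` with the hanging instances removed.

Own code; standard axioms.
-/

namespace Summit.Ventures.PercRepro2

open UnionCluster

namespace CovForm

namespace TypedRed

open RootBundle

/-! ## The root-bundle composition -/

section Bundle

variable {V : Type*} {E : Type*} [Fintype V] [DecidableEq V] [Fintype E] [DecidableEq E]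
variable {R : Type*} [Field R] [LinearOrder R] [IsStrictOrderedRing R]

omit [Fintype E] in
/-- The unmarked typed vertices of the virtual instance of the root-bundle identity are those of
the rest, plus `v` when `v` is unmarked. -/
lemma unmarkedTyped_virtual_subset (ends : E → Sym2 V) (o a₁ a₂ a₃ b v : V) (F L : Finset E)
    {h₁ h₂ : E} (h₁L : h₁ ∈ L) (h₂L : h₂ ∈ L) (h12 : h₁ ≠ h₂) (τ' : E → ℕ) :
    unmarkedTyped (Function.update (Function.update ends h₁ s(v, a₁)) h₂ s(v, a₂)) o a₁ a₂ a₃ b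
        (mixedPart (insert h₂ (insert h₁ (F \ L))) τ') ⊆
      unmarkedTyped ends o a₁ a₂ a₃ b (F \ L) ∪ ({v} \ markSet o a₁ a₂ a₃ b) := by
  intro x hx
  rw [mem_unmarkedTyped] at hx
  obtain ⟨⟨e, he, hxe⟩, hxo, hx1, hx2, hx3, hxb⟩ := hx
  obtain ⟨he, -⟩ := mem_mixedPart.1 he
  rw [Finset.mem_union, mem_unmarkedTyped, Finset.mem_sdiff, Finset.mem_singleton, mem_markSet]
  rcases Finset.mem_insert.1 he with rfl | he
  · rw [Function.update_self] at hxe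
    rcases Sym2.mem_iff.1 hxe with rfl | rfl
    · refine Or.inr ⟨rfl, ?_⟩
      rintro (h | h | h | h | h)
      · exact hxo h
      · exact hx1 h
      · exact hx2 h
      · exact hx3 h
      · exact hxb h
    · exact absurd rfl hx2
  · rcases Finset.mem_insert.1 he with rfl | he
    · rw [Function.update_of_ne h12, Function.update_self] at hxe
      rcases Sym2.mem_iff.1 hxe with rfl | rfl
      · refine Or.inr ⟨rfl, ?_⟩
        rintro (h | h | h | h | h)
        · exact hxo h
        · exact hx1 h
        · exact hx2 h
        · exact hx3 h
        · exact hxb h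
      · exact absurd rfl hx1
    · have hne1 : e ≠ h₁ := fun h => (Finset.mem_sdiff.1 he).2 (h ▸ h₁L)
      have hne2 : e ≠ h₂ := fun h => (Finset.mem_sdiff.1 he).2 (h ▸ h₂L)
      rw [Function.update_of_ne hne2, Function.update_of_ne hne1] at hxe
      exact Or.inl ⟨⟨e, he, hxe⟩, hxo, hx1, hx2, hx3, hxb⟩

/-- **The root-bundle composition**: an instance carrying a root bundle (`I` hanging on `v, a₁, a₂`
through the typed edges `L`, `h₁ ≠ h₂ ∈ L`) whose rest has at most one unmarked typed vertex
(`v` counted when unmarked) has nonnegative typed count — the virtual instances of the identity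
are instances with at most one unmarked typed vertex. -/
theorem typedCount_nonneg_of_rootBundle_rest_le_one (ends : E → Sym2 V) (o a₁ a₂ a₃ b : V)
    {I : Set V} {v : V} (hv : v ∉ I) (hI : ∀ x ∈ I, x ≠ o ∧ x ≠ a₁ ∧ x ≠ a₂ ∧ x ≠ a₃ ∧ x ≠ b)
    {L : Finset E} (hLI : ∀ e ∈ L, ∀ x ∈ ends e, x ∈ I ∨ x = v ∨ x = a₁ ∨ x = a₂)
    {h₁ h₂ : E} (h₁L : h₁ ∈ L) (h₂L : h₂ ∈ L) (h12 : h₁ ≠ h₂) {F : Finset E} (hLF : L ⊆ F)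
    (z : Config E) (τ : E → ℕ) (hτ : ∀ e ∈ F, τ e = 1 ∨ τ e = 2)
    (hcl : ∀ e, e ∉ L → (∃ x ∈ I, x ∈ ends e) → e ∉ F ∧ z e = false)
    (hrest : (unmarkedTyped ends o a₁ a₂ a₃ b (F \ L) ∪ ({v} \ markSet o a₁ a₂ a₃ b)).card ≤ 1) :
    0 ≤ typedCount F z τ (K3 ends o a₁ a₂ a₃ b : Config E → Config E → Config E → R) := by
  refine typedCount_nonneg_of_rootBundle ends o a₁ a₂ a₃ b hv hI hLI h₁L h₂L h12 hLF z τ hcl ?_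
  intro k₁ k₂ hk₁ hk₂
  have hh₁ : h₁ ∉ F \ L := fun h => (Finset.mem_sdiff.1 h).2 h₁L
  have hh₂ : h₂ ∉ insert h₁ (F \ L) := by
    rw [Finset.mem_insert, not_or]
    exact ⟨Ne.symm h12, fun h => (Finset.mem_sdiff.1 h).2 h₂L⟩
  have hτ3 : ∀ e ∈ insert h₂ (insert h₁ (F \ L)),
      Function.update (Function.update τ h₁ k₁) h₂ k₂ e ≤ 3 := by
    intro e he
    rcases Finset.mem_insert.1 he with rfl | he
    · rw [Function.update_self]; exact hk₂
    · rw [Function.update_of_ne (fun h => hh₂ (by rw [← h]; exact he))]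
      rcases Finset.mem_insert.1 he with rfl | he
      · rw [Function.update_self]; exact hk₁
      · rw [Function.update_of_ne (fun h => hh₁ (by rw [← h]; exact he))]
        rcases hτ e (Finset.mem_sdiff.1 he).1 with h | h <;> omega
  rw [typedCount_mixed_of_le_three _ _ _ hτ3]
  refine typedCount_nonneg_of_unmarked_le_one _ o a₁ a₂ a₃ b _ _ _
    (fun e he => (mem_mixedPart.1 he).2) ?_
  exact (Finset.card_le_card
    (unmarkedTyped_virtual_subset ends o a₁ a₂ a₃ b v F L h₁L h₂L h12 _)).trans hrest

end Bundle

/-! ## Hanging vertices on the class with at most two unmarked typed vertices -/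

section Hangs

variable {V : Type*} {E : Type*} [Fintype V] [DecidableEq V] [Fintype E] [DecidableEq E]
variable {R : Type*} [Field R] [LinearOrder R] [IsStrictOrderedRing R]

omit [Fintype V] [DecidableEq V] [Fintype E] [DecidableEq E] in
/-- `u` HANGS on the roots and `v`: some typed edge joins `u` to `v ≠ u`, and every typed edge at
`u` has its ends in `{u, v, a₁, a₂}` (a hat when `v` is a mark; the adjacent pair `u ~ {a₁, a₂, w}`
when `v = w` is unmarked). -/
def Hangs (ends : E → Sym2 V) (a₁ a₂ : V) (F : Finset E) (u v : V) : Prop :=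
  u ≠ v ∧ (∃ e ∈ F, ends e = s(u, v)) ∧
    ∀ e ∈ F, u ∈ ends e → ∀ x ∈ ends e, x = u ∨ x = v ∨ x = a₁ ∨ x = a₂

/-- **Row 2′TRI on an instance with at most two unmarked typed vertices one of which hangs on the
roots and a third vertex** (pinned closed; at least two typed edges at the hanging vertex). -/
theorem typedCount_nonneg_of_hangs_unmarked_le_two (ends : E → Sym2 V) (o a₁ a₂ a₃ b : V)
    (F : Finset E) (τ : E → ℕ) (hτ : ∀ e ∈ F, τ e = 1 ∨ τ e = 2)
    (h2 : (unmarkedTyped ends o a₁ a₂ a₃ b F).card ≤ 2) {u v : V}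
    (hu : u ∈ unmarkedTyped ends o a₁ a₂ a₃ b F)
    (hdeg : 2 ≤ (F.filter fun e => u ∈ ends e).card) (hh : Hangs ends a₁ a₂ F u v) :
    0 ≤ typedCount F (fun _ => false) τ
      (K3 ends o a₁ a₂ a₃ b : Config E → Config E → Config E → R) := by
  obtain ⟨huv, ⟨e₀, he₀, hE₀⟩, hang⟩ := hh
  obtain ⟨-, huo, hu1, hu2, hu3, hub⟩ := mem_unmarkedTyped.1 hu
  set L := F.filter (fun e => u ∈ ends e) with hL
  have hmemL : ∀ e, e ∈ L ↔ e ∈ F ∧ u ∈ ends e := fun e => Finset.mem_filter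
  obtain ⟨h₁, h₁L, h₂, h₂L, h12⟩ : ∃ h₁ ∈ L, ∃ h₂ ∈ L, h₁ ≠ h₂ :=
    Finset.one_lt_card.1 (by omega)
  refine typedCount_nonneg_of_rootBundle_rest_le_one ends o a₁ a₂ a₃ b (I := {u}) (v := v)
    (fun h => huv (Set.mem_singleton_iff.1 h).symm)
    (fun x hx => by rw [Set.mem_singleton_iff.1 hx]; exact ⟨huo, hu1, hu2, hu3, hub⟩)
    (fun e he x hx => ?_) h₁L h₂L h12 (Finset.filter_subset _ _) _ τ hτ (fun e heL hex => ?_) ?_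
  · obtain ⟨heF, hue⟩ := (hmemL e).1 he
    rcases hang e heF hue x hx with h | h | h | h
    · exact Or.inl (by rw [h]; exact Set.mem_singleton u)
    · exact Or.inr (Or.inl h)
    · exact Or.inr (Or.inr (Or.inl h))
    · exact Or.inr (Or.inr (Or.inr h))
  · obtain ⟨x, hx, hxe⟩ := hex
    rw [Set.mem_singleton_iff.1 hx] at hxe
    exact ⟨fun heF => heL ((hmemL e).2 ⟨heF, hxe⟩), rfl⟩
  · -- the rest and `v` lie in the unmarked typed vertices minus `u`
    have hsub : unmarkedTyped ends o a₁ a₂ a₃ b (F \ L) ∪ ({v} \ markSet o a₁ a₂ a₃ b) ⊆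
        (unmarkedTyped ends o a₁ a₂ a₃ b F).erase u := by
      intro x hx
      rw [Finset.mem_erase]
      rcases Finset.mem_union.1 hx with hx | hx
      · refine ⟨?_, unmarkedTyped_mono Finset.sdiff_subset hx⟩
        rintro rfl
        obtain ⟨⟨e, he, hxe⟩, -⟩ := mem_unmarkedTyped.1 hx
        exact (Finset.mem_sdiff.1 he).2 ((hmemL e).2 ⟨(Finset.mem_sdiff.1 he).1, hxe⟩)
      · rw [Finset.mem_sdiff, Finset.mem_singleton, mem_markSet, not_or, not_or, not_or,
          not_or] at hx
        obtain ⟨rfl, hvo, hv1, hv2, hv3, hvb⟩ := hx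
        refine ⟨Ne.symm huv, mem_unmarkedTyped.2 ⟨⟨e₀, he₀, ?_⟩, hvo, hv1, hv2, hv3, hvb⟩⟩
        rw [hE₀]; exact Sym2.mem_mk_right _ _
    have hcard := Finset.card_le_card hsub
    rw [Finset.card_erase_of_mem hu] at hcard
    omega

end Hangs

/-! ## The seven-vertex hypothesis without the hanging instances -/

section Seven

variable {V : Type*} {E : Type*} [Fintype V] [DecidableEq V] [Fintype E] [DecidableEq E]
variable {R : Type*} [Field R] [LinearOrder R] [IsStrictOrderedRing R]

/-- **Row 2′TRI on the residual instances with at most two unmarked typed vertices** from the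
instances in which NO unmarked typed vertex hangs on the roots and a third vertex. -/
theorem typedCount_nonneg_of_residual_unmarked_le_two_of_noHang
    (hNR : ∀ (ends : E → Sym2 V) (o a₁ a₂ a₃ b : V) (F : Finset E) (τ : E → ℕ),
      (∀ e ∈ F, τ e = 1 ∨ τ e = 2) → Residual ends o a₁ a₂ a₃ b F →
        (unmarkedTyped ends o a₁ a₂ a₃ b F).card ≤ 2 →
        (∀ u ∈ unmarkedTyped ends o a₁ a₂ a₃ b F, ∀ v, ¬ Hangs ends a₁ a₂ F u v) →
        0 ≤ typedCount F (fun _ => false) τ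
          (K3 ends o a₁ a₂ a₃ b : Config E → Config E → Config E → R))
    (ends : E → Sym2 V) (o a₁ a₂ a₃ b : V) (F : Finset E) (τ : E → ℕ)
    (hτ : ∀ e ∈ F, τ e = 1 ∨ τ e = 2) (hres : Residual ends o a₁ a₂ a₃ b F)
    (h2 : (unmarkedTyped ends o a₁ a₂ a₃ b F).card ≤ 2) :
    0 ≤ typedCount F (fun _ => false) τ
      (K3 ends o a₁ a₂ a₃ b : Config E → Config E → Config E → R) := by
  by_cases hh : ∃ u ∈ unmarkedTyped ends o a₁ a₂ a₃ b F, ∃ v, Hangs ends a₁ a₂ F u v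
  · obtain ⟨u, hu, v, hhang⟩ := hh
    obtain ⟨⟨e₀, he₀, hue₀⟩, huo, hu1, hu2, hu3, hub⟩ := mem_unmarkedTyped.1 hu
    have hdeg : 3 ≤ (F.filter fun e => u ∈ ends e).card :=
      hres.reduced.typedDeg_unmarked huo hu1 hu2 hu3 hub he₀ hue₀
    exact typedCount_nonneg_of_hangs_unmarked_le_two ends o a₁ a₂ a₃ b F τ hτ h2 hu
      (by omega) hhang
  · exact hNR ends o a₁ a₂ a₃ b F τ hτ hres h2 fun u hu v hv => hh ⟨u, hu, v, hv⟩

/-- **Seven vertices, the hanging instances removed**: (HCOV) on every graph with at most seven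
vertices and five distinct marks follows from row 2′TRI on the residual instances with at most
two unmarked typed vertices none of which hangs on the roots and a third vertex — the hats and
the adjacent pairs `u ~ {a₁, a₂, w}` are theorems. -/
theorem HCov_of_card_le_seven_of_residual_noHang
    (hNR : ∀ (ends : E → Sym2 V) (o a₁ a₂ a₃ b : V) (F : Finset E) (τ : E → ℕ),
      (∀ e ∈ F, τ e = 1 ∨ τ e = 2) → Residual ends o a₁ a₂ a₃ b F →
        (unmarkedTyped ends o a₁ a₂ a₃ b F).card ≤ 2 →
        (∀ u ∈ unmarkedTyped ends o a₁ a₂ a₃ b F, ∀ v, ¬ Hangs ends a₁ a₂ F u v) →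
        0 ≤ typedCount F (fun _ => false) τ
          (K3 ends o a₁ a₂ a₃ b : Config E → Config E → Config E → R))
    (ends : E → Sym2 V) (p : E → R) (hp : IsProbVec p) (o a₁ a₂ a₃ b : V)
    (hV : Fintype.card V ≤ 7) (h12 : a₁ ≠ a₂) (h13 : a₁ ≠ a₃) (h23 : a₂ ≠ a₃) (ho1 : o ≠ a₁)
    (ho2 : o ≠ a₂) (ho3 : o ≠ a₃) (hob : o ≠ b) (hb1 : b ≠ a₁) (hb2 : b ≠ a₂) (hb3 : b ≠ a₃) :
    HCov p ends o a₁ a₂ a₃ b :=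
  HCov_of_card_le_seven_of_residual
    (fun ends o a₁ a₂ a₃ b F τ hτ hres h2 =>
      typedCount_nonneg_of_residual_unmarked_le_two_of_noHang hNR ends o a₁ a₂ a₃ b F τ hτ hres h2)
    ends p hp o a₁ a₂ a₃ b hV h12 h13 h23 ho1 ho2 ho3 hob hb1 hb2 hb3

end Seven

end TypedRed

end CovForm

end Summit.Ventures.PercRepro2
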